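import Literature.Analysis.FluidPDE.TaoCascadeBlowupDynamics
import HarnessLib

/-!
# Tao's cascade ODE: the checkpoint bounds with a general `X₃`-coefficient, and the erratum to (6.17)

T. Tao, *Finite time blowup for an averaged three-dimensional Navier–Stokes equation*,
J. Amer. Math. Soc. 29 (2016), 601–674; arXiv:1402.0290v3, §6.2–6.3 (arXiv v3 pp. 51–55). Equation
numbers below are those of arXiv v3; the sibling files `TaoCascadeODE.lean`,
`TaoCascadeBlowupDynamics.lean` number the same displays two lower (their "(6.0)–(6.8)" = v3
(6.1)–(6.10), their Prop. 6.3 "(6.9)–(6.25)" = v3 (6.11)–(6.27), their Prop. 6.4 "(6.26)–(6.40)" =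
v3 (6.28)–(6.42)).

## The erratum

In v3 the transition-state bound on the third mode reads, at every checkpoint,
`|X_{3,n}(t_n)| ≤ 10⁻⁵ exp(-K¹⁰) ε² e_n` ((6.17) in Prop. 6.3, (6.32) in Prop. 6.4, (6.71) in Prop. 6.5,
(6.108) in Prop. 6.12), and this is what `TaoCascade.StateBounds.x3_abs_le` vendors. The printed proof
does not re-establish this constant: Prop. 6.13, (6.117), only gives
`|c₁(t)| ≲ K^{-1/4} exp(-K¹⁰/2) ε²`, and p. 67 derives Prop. 6.12 "from Proposition 6.15 and
Proposition 6.13". The discrepancy was reported by a reader (comment of 31 March 2017 on the author's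
blog page for the paper, "In section 6, I don't see how you got inequality (6.71) … you can just
replace `exp(-K¹⁰)` with `exp(-K¹⁰/2)` in (6.17), (6.32), (6.71), and (6.108)") and acknowledged by
the author there ("Thanks for this, this will be corrected in the next version of the ms.")
[cite: TaoBlog2014AveragedNSErratum, comment of 2017-03-31]; arXiv v3 (1 Apr 2015) is the latest
version, so the correction is unpublished. The mismatch itself is visible in the source:
[cite: Tao2016AveragedNS, §6.6 Prop. 6.13 (6.117) vs §6.5 Prop. 6.12 (6.108) and p. 67].

## What is here

* `StateBoundsWith γ`, `BlowupCheckpointsWith γ`, `blowupDynamicsWith γ`, `blowupDynamicsStepWith γ`: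
  the displays of Props. 6.3/6.4 with the coefficient of `ε² e_n` in (6.17)/(6.32) replaced by a
  parameter `γ` (a function of `K` in the two `Prop`s); `γ K = 10⁻⁵ exp(-K¹⁰)` gives back the vendored
  statements literally (`stateBoundsWith_printed_iff`, …, `blowupDynamicsStepWith_printed_iff`), and
  `γ K = 10⁻⁵ exp(-K¹⁰/2)` gives the corrected Props. 6.3/6.4 (`blowupDynamicsCorrected`,
  `blowupDynamicsStepCorrected`, named facts, not asserted).
* The two reductions of `TaoCascadeBlowupDynamics.lean` (Thm. 6.2 ⇐ Prop. 6.3 ⇐ Prop. 6.4, §6.2 p. 53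
  and §6.3 p. 53) re-proved for every `γ ≥ 0`: `noGlobalODESolution_of_blowupDynamicsWith`,
  `blowupDynamicsWith_of_blowupDynamicsStepWith`.
* The observation that, being stated under the contradiction hypothesis of Thm. 6.2 ("suppose for
  contradiction that we may find … `X_{i,n}`, `E_n` with the stated properties (6.1)–(6.10)"), the
  vendored Props. 6.3 and 6.4 are *equivalent* to Thm. 6.2 (`blowupDynamicsStep_iff_noGlobalODESolution`):
  in particular `blowupDynamicsStepWith γ → blowupDynamicsStep` for every `γ ≥ 0`
  (`blowupDynamicsStep_of_blowupDynamicsStepWith`), so the corrected chain discharges the printed fact.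

## References

* T. Tao, J. Amer. Math. Soc. 29 (2016), 601–674 = arXiv:1402.0290v3, §6.2 Prop. 6.3 (6.11)–(6.27),
  p. 53 ("Let us now see how the above proposition implies Theorem 6.2"), §6.3 Prop. 6.4 (6.28)–(6.42),
  §6.5 Prop. 6.12 (6.108), §6.6 Prop. 6.13 (6.117), p. 67. [`Tao2016AveragedNS`]
* T. Tao, blog post for the paper (What's new, 4 Feb 2014), comment of 31 March 2017 and the author's
  reply (the erratum). [`TaoBlog2014AveragedNSErratum`]
-/

noncomputable section

open Set

namespace Literature.Analysis.FluidPDE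

namespace TaoCascade

/-! ## The checkpoint bounds with a general coefficient in (6.17) -/

/-- **Transition-state bounds (viii) of Tao's Prop. 6.3 with a general `X₃`-coefficient `γ`**: at
scale `n`, checkpoint time `s = t_n` and amplitude `a = e_n > 0`,
(6.15) `X_{1,n}(t_n) = e_n`; (6.16) `|X_{2,n}(t_n)| ≤ 10⁻⁵ ε e_n`; (6.17)_γ `|X_{3,n}(t_n)| ≤ γ ε² e_n`;
(6.18) `X_{3,n}(t_n) ≥ -(1+ε₀)^{-n₀/4} e_n`; (6.19) `|X_{4,n}(t_n)| ≤ K^{-10} e_n`;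
(6.20) `E_{n-1}(t_n) ≤ K^{-20} e_n²` (arXiv v3 numbering). The printed (6.17) is `γ = 10⁻⁵ exp(-K¹⁰)`
(`stateBoundsWith_printed_iff`); the author's correction is `γ = 10⁻⁵ exp(-K¹⁰/2)` (module docstring).
[cite: Tao2016AveragedNS, §6.2 Prop. 6.3 (6.15)–(6.20)] -/
structure StateBoundsWith (γ ε₀ K ε : ℝ) (n₀ : ℤ) (X : Fin 4 → ℤ → ℝ → ℝ) (E : ℤ → ℝ → ℝ) (n : ℤ)
    (s a : ℝ) : Prop where
  /-- The amplitude `e_n` is positive. -/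
  pos : 0 < a
  /-- (6.15) `X_{1,n}(t_n) = e_n`. -/
  x1_eq : X 0 n s = a
  /-- (6.16) `|X_{2,n}(t_n)| ≤ 10⁻⁵ ε e_n`. -/
  x2_abs_le : |X 1 n s| ≤ 1 / 10 ^ 5 * ε * a
  /-- (6.17)_γ `|X_{3,n}(t_n)| ≤ γ ε² e_n`. -/
  x3_abs_le : |X 2 n s| ≤ γ * ε ^ 2 * a
  /-- (6.18) `X_{3,n}(t_n) ≥ -(1+ε₀)^{-n₀/4} e_n`. -/
  x3_ge : -((1 + ε₀) ^ (-(n₀ : ℝ) / 4) * a) ≤ X 2 n s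
  /-- (6.19) `|X_{4,n}(t_n)| ≤ K^{-10} e_n`. -/
  x4_abs_le : |X 3 n s| ≤ (K ^ 10)⁻¹ * a
  /-- (6.20) `E_{n-1}(t_n) ≤ K^{-20} e_n²`. -/
  energy_prev_le : E (n - 1) s ≤ (K ^ 20)⁻¹ * a ^ 2

/-- With `γ = 10⁻⁵ exp(-K¹⁰)` the bounds `StateBoundsWith` are literally the printed (viii) of Prop. 6.3
(`StateBounds`). [cite: Tao2016AveragedNS, §6.2 Prop. 6.3 (6.15)–(6.20)] -/
theorem stateBoundsWith_printed_iff {ε₀ K ε : ℝ} {n₀ : ℤ} {X : Fin 4 → ℤ → ℝ → ℝ} {E : ℤ → ℝ → ℝ}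
    {n : ℤ} {s a : ℝ} :
    StateBoundsWith (1 / 10 ^ 5 * Real.exp (-K ^ 10)) ε₀ K ε n₀ X E n s a ↔
      StateBounds ε₀ K ε n₀ X E n s a :=
  ⟨fun h => ⟨h.pos, h.x1_eq, h.x2_abs_le, h.x3_abs_le, h.x3_ge, h.x4_abs_le, h.energy_prev_le⟩,
    fun h => ⟨h.pos, h.x1_eq, h.x2_abs_le, h.x3_abs_le, h.x3_ge, h.x4_abs_le, h.energy_prev_le⟩⟩

/-- **The conclusion (vi)–(ix) of Tao's Prop. 6.3 up to level `N`, with a general `X₃`-coefficient `γ`**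
in (6.17): (6.11) `t_{n₀} = 0`, (6.12) `e_{n₀} = 1`, `StateBoundsWith γ` for `n₀ ≤ n ≤ N`, and the
(unchanged) scale-evolution / additional / energy bounds `StepBounds` ((6.13)–(6.14), (6.21)–(6.27))
for `n₀ < n ≤ N`. [cite: Tao2016AveragedNS, §6.2 Prop. 6.3 (6.11)–(6.27)] -/
structure BlowupCheckpointsWith (γ ε₀ K ε : ℝ) (n₀ N : ℤ) (X : Fin 4 → ℤ → ℝ → ℝ) (E : ℤ → ℝ → ℝ)
    (t e : ℤ → ℝ) : Prop where
  /-- (6.11) `t_{n₀} = 0`. -/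
  t_init : t n₀ = 0
  /-- (6.12) `e_{n₀} = 1`. -/
  e_init : e n₀ = 1
  /-- (viii) with coefficient `γ`, at every scale `n₀ ≤ n ≤ N`. -/
  state : ∀ n, n₀ ≤ n → n ≤ N → StateBoundsWith γ ε₀ K ε n₀ X E n (t n) (e n)
  /-- (vii), (6.21)–(6.24), (ix) for every `n₀ < n ≤ N`. -/
  step : ∀ n, n₀ < n → n ≤ N → StepBounds ε₀ K ε X E n (t (n - 1)) (t n) (e (n - 1)) (e n)

/-- With `γ = 10⁻⁵ exp(-K¹⁰)`, `BlowupCheckpointsWith` is literally the printed conclusion of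
Prop. 6.3 (`BlowupCheckpoints`). [cite: Tao2016AveragedNS, §6.2 Prop. 6.3 (6.11)–(6.27)] -/
theorem blowupCheckpointsWith_printed_iff {ε₀ K ε : ℝ} {n₀ N : ℤ} {X : Fin 4 → ℤ → ℝ → ℝ}
    {E : ℤ → ℝ → ℝ} {t e : ℤ → ℝ} :
    BlowupCheckpointsWith (1 / 10 ^ 5 * Real.exp (-K ^ 10)) ε₀ K ε n₀ N X E t e ↔
      BlowupCheckpoints ε₀ K ε n₀ N X E t e :=
  ⟨fun h => ⟨h.t_init, h.e_init, fun n hn hn' => stateBoundsWith_printed_iff.1 (h.state n hn hn'),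
      h.step⟩,
    fun h => ⟨h.t_init, h.e_init, fun n hn hn' => stateBoundsWith_printed_iff.2 (h.state n hn hn'),
      h.step⟩⟩

/-- **Tao's Prop. 6.3 (blow-up dynamics) with a general `X₃`-coefficient `γ = γ(K)` in (6.17)**, same
parameter regime and contradiction hypothesis as the printed statement (`blowupDynamics`, which is the
case `γ K = 10⁻⁵ exp(-K¹⁰)`, see `blowupDynamicsWith_printed_iff`). A statement schema (not asserted
for any `γ`). [cite: Tao2016AveragedNS, §6.2 Prop. 6.3] -/
def blowupDynamicsWith (γ : ℝ → ℝ) : Prop :=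
  ∀ ε₀ : ℝ, 0 < ε₀ → ε₀ < 1 →
    ∃ K₀ : ℝ, ∀ K : ℝ, K₀ ≤ K → 0 < K →
      ∃ e₀ : ℝ, 0 < e₀ ∧ ∀ ε : ℝ, 0 < ε → ε ≤ e₀ →
        ∀ C₁ C₂ : ℝ, 0 ≤ C₁ → 0 ≤ C₂ →
          ∃ N₀ : ℤ, ∀ n₀ : ℤ, N₀ ≤ n₀ →
            ∀ (X : Fin 4 → ℤ → ℝ → ℝ) (E : ℤ → ℝ → ℝ), TaoODESystem ε₀ K ε C₁ C₂ n₀ X E →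
              ∀ N : ℤ, n₀ ≤ N → ∃ t e : ℤ → ℝ, BlowupCheckpointsWith (γ K) ε₀ K ε n₀ N X E t e

/-- **Tao's Prop. 6.4 (blow-up dynamics, inductive case) with a general `X₃`-coefficient `γ = γ(K)`**
in (6.17)/(6.32): from checkpoints up to level `N` obeying (6.11)–(6.27) with coefficient `γ`, a next
checkpoint `(t_{N+1}, e_{N+1})` obeying (6.28)–(6.42) with the same coefficient. The printed statement
`blowupDynamicsStep` is the case `γ K = 10⁻⁵ exp(-K¹⁰)` (`blowupDynamicsStepWith_printed_iff`); the
corrected one is `blowupDynamicsStepCorrected`. A statement schema (not asserted for any `γ`).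
[cite: Tao2016AveragedNS, §6.3 Prop. 6.4] -/
def blowupDynamicsStepWith (γ : ℝ → ℝ) : Prop :=
  ∀ ε₀ : ℝ, 0 < ε₀ → ε₀ < 1 →
    ∃ K₀ : ℝ, ∀ K : ℝ, K₀ ≤ K → 0 < K →
      ∃ e₀ : ℝ, 0 < e₀ ∧ ∀ ε : ℝ, 0 < ε → ε ≤ e₀ →
        ∀ C₁ C₂ : ℝ, 0 ≤ C₁ → 0 ≤ C₂ →
          ∃ N₀ : ℤ, ∀ n₀ : ℤ, N₀ ≤ n₀ →
            ∀ (X : Fin 4 → ℤ → ℝ → ℝ) (E : ℤ → ℝ → ℝ), TaoODESystem ε₀ K ε C₁ C₂ n₀ X E →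
              ∀ N : ℤ, n₀ ≤ N → ∀ t e : ℤ → ℝ, BlowupCheckpointsWith (γ K) ε₀ K ε n₀ N X E t e →
                ∃ s a : ℝ, StateBoundsWith (γ K) ε₀ K ε n₀ X E (N + 1) s a ∧
                  StepBounds ε₀ K ε X E (N + 1) (t N) s (e N) a

/-- `blowupDynamicsWith` at the printed coefficient is literally `blowupDynamics`.
[cite: Tao2016AveragedNS, §6.2 Prop. 6.3] -/
theorem blowupDynamicsWith_printed_iff :
    blowupDynamicsWith (fun K => 1 / 10 ^ 5 * Real.exp (-K ^ 10)) ↔ blowupDynamics := by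
  unfold blowupDynamicsWith blowupDynamics
  simp only [blowupCheckpointsWith_printed_iff]

/-- `blowupDynamicsStepWith` at the printed coefficient is literally `blowupDynamicsStep`.
[cite: Tao2016AveragedNS, §6.3 Prop. 6.4] -/
theorem blowupDynamicsStepWith_printed_iff :
    blowupDynamicsStepWith (fun K => 1 / 10 ^ 5 * Real.exp (-K ^ 10)) ↔ blowupDynamicsStep := by
  unfold blowupDynamicsStepWith blowupDynamicsStep
  simp only [blowupCheckpointsWith_printed_iff, stateBoundsWith_printed_iff]

/-- **Tao's Prop. 6.3, corrected form**: the blow-up dynamics (6.11)–(6.27) with (6.17) replaced by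
`|X_{3,n}(t_n)| ≤ 10⁻⁵ exp(-K¹⁰/2) ε² e_n`, i.e. with `exp(-K¹⁰)` replaced by `exp(-K¹⁰/2)` as in the
author-acknowledged correction recorded in the module docstring (the printed induction closes only with
the weaker constant, cf. Prop. 6.13 (6.117); erratum: `TaoBlog2014AveragedNSErratum`). A named fact
(not asserted). [cite: Tao2016AveragedNS, §6.2 Prop. 6.3; §6.6 Prop. 6.13 (6.117)] -/
def blowupDynamicsCorrected : Prop :=
  blowupDynamicsWith fun K => 1 / 10 ^ 5 * Real.exp (-K ^ 10 / 2)

/-- **Tao's Prop. 6.4, corrected form**: the inductive step with (6.17)/(6.32) carrying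
`10⁻⁵ exp(-K¹⁰/2)` in place of `10⁻⁵ exp(-K¹⁰)` (author-acknowledged correction, module docstring;
erratum: `TaoBlog2014AveragedNSErratum`). A named fact (not asserted).
[cite: Tao2016AveragedNS, §6.3 Prop. 6.4; §6.6 Prop. 6.13 (6.117)] -/
def blowupDynamicsStepCorrected : Prop :=
  blowupDynamicsStepWith fun K => 1 / 10 ^ 5 * Real.exp (-K ^ 10 / 2)

/-! ## Props. 6.3/6.4 as printed are equivalent to Thm. 6.2 -/

/-- Being stated under the contradiction hypothesis of Thm. 6.2, the printed Prop. 6.4 follows from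
Thm. 6.2 vacuously; with `noGlobalODESolution_of_blowupDynamicsStep` the two named facts are
equivalent. [cite: Tao2016AveragedNS, §6.3 Prop. 6.4] -/
theorem blowupDynamicsStep_of_noGlobalODESolution (h : noGlobalODESolution) :
    blowupDynamicsStep := by
  intro ε₀ hε₀ hε₀1
  obtain ⟨K₀, hK⟩ := h ε₀ hε₀ hε₀1
  refine ⟨K₀, fun K hK₀K hKpos => ?_⟩
  obtain ⟨e₀, he₀, hε⟩ := hK K hK₀K hKpos
  refine ⟨e₀, he₀, fun ε hεpos hεle C₁ C₂ hC₁ hC₂ => ?_⟩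
  obtain ⟨N₀, hN⟩ := hε ε hεpos hεle C₁ C₂ hC₁ hC₂
  exact ⟨N₀, fun n₀ hn₀ X E hsol => absurd ⟨X, E, hsol⟩ (hN n₀ hn₀)⟩

/-- Prop. 6.4 as printed ⟺ Thm. 6.2. [cite: Tao2016AveragedNS, §6.3 Prop. 6.4] -/
theorem blowupDynamicsStep_iff_noGlobalODESolution : blowupDynamicsStep ↔ noGlobalODESolution :=
  ⟨noGlobalODESolution_of_blowupDynamicsStep, blowupDynamicsStep_of_noGlobalODESolution⟩

/-- Prop. 6.3 as printed ⟺ Thm. 6.2. [cite: Tao2016AveragedNS, §6.2 Prop. 6.3] -/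
theorem blowupDynamics_iff_noGlobalODESolution : blowupDynamics ↔ noGlobalODESolution :=
  ⟨noGlobalODESolution_of_blowupDynamics, fun h =>
    blowupDynamics_of_blowupDynamicsStep (blowupDynamicsStep_of_noGlobalODESolution h)⟩

/-! ## Consequences of the checkpoint bounds, general coefficient -/

section Consequences

variable {γ ε₀ K ε : ℝ} {n₀ N : ℤ} {X : Fin 4 → ℤ → ℝ → ℝ} {E : ℤ → ℝ → ℝ} {t e : ℤ → ℝ}

/-- Lower amplitude bound `e_n ≥ (1+ε₀)^{-(n-n₀)/100}` for `n₀ ≤ n ≤ N`, from (6.12)–(6.13), for any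
coefficient `γ` (p. 53: "from (6.15), (6.13), (6.12) we have `|X_{1,N}(t_N)| ≥ (1+ε₀)^{-N/100}`").
[cite: Tao2016AveragedNS, §6.2 p. 53] -/
theorem BlowupCheckpointsWith.rpow_le_amp (h : BlowupCheckpointsWith γ ε₀ K ε n₀ N X E t e)
    (hε₀ : 0 < ε₀) {n : ℤ} (hn₀ : n₀ ≤ n) (hnN : n ≤ N) :
    (1 + ε₀) ^ (-((n : ℝ) - n₀) / 100) ≤ e n := by
  induction n, hn₀ using Int.leInduction with
  | base => simp [h.e_init]
  | succ n hmn ih =>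
    have ih' := ih (by omega)
    have hs := h.step (n + 1) (by omega) hnN
    have h1 : (0 : ℝ) < 1 + ε₀ := by linarith
    have hq : 0 < (1 + ε₀) ^ (-(1 : ℝ) / 100) := Real.rpow_pos_of_pos h1 _
    have hexp : -(((n + 1 : ℤ) : ℝ) - n₀) / 100 = -(1 : ℝ) / 100 + -((n : ℝ) - n₀) / 100 := by
      push_cast; ring
    calc (1 + ε₀) ^ (-(((n + 1 : ℤ) : ℝ) - n₀) / 100)
        = (1 + ε₀) ^ (-(1 : ℝ) / 100) * (1 + ε₀) ^ (-((n : ℝ) - n₀) / 100) := by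
          rw [hexp, Real.rpow_add h1]
      _ ≤ (1 + ε₀) ^ (-(1 : ℝ) / 100) * e n := by gcongr
      _ = (1 + ε₀) ^ (-(1 : ℝ) / 100) * e (n + 1 - 1) := by simp
      _ ≤ e (n + 1) := hs.amp_ge

/-- The amplitudes are positive on `[n₀, N]`. [cite: Tao2016AveragedNS, §6.2 Prop. 6.3] -/
theorem BlowupCheckpointsWith.amp_pos (h : BlowupCheckpointsWith γ ε₀ K ε n₀ N X E t e) {n : ℤ}
    (hn₀ : n₀ ≤ n) (hnN : n ≤ N) : 0 < e n :=
  (h.state n hn₀ hnN).pos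

/-- The checkpoints restricted to a lower level `M ≤ N`. [cite: Tao2016AveragedNS, §6.2 Prop. 6.3] -/
theorem BlowupCheckpointsWith.mono (h : BlowupCheckpointsWith γ ε₀ K ε n₀ N X E t e) {M : ℤ}
    (hM : M ≤ N) : BlowupCheckpointsWith γ ε₀ K ε n₀ M X E t e where
  t_init := h.t_init
  e_init := h.e_init
  state n hn hn' := h.state n hn (hn'.trans hM)
  step n hn hn' := h.step n hn (hn'.trans hM)

/-- The geometric bound on the checkpoint times of p. 53, for any coefficient `γ`: with `q = 1+ε₀`,
`A = 100 q^{-5n₀/2}` and `ρ = q^{-249/100} < 1`, `0 ≤ t_n ≤ A (1 - ρ^{n-n₀}) / (1 - ρ)` for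
`n₀ ≤ n ≤ N`. [cite: Tao2016AveragedNS, §6.2 p. 53] -/
theorem BlowupCheckpointsWith.time_le (h : BlowupCheckpointsWith γ ε₀ K ε n₀ N X E t e)
    (hε₀ : 0 < ε₀) {n : ℤ} (hn₀ : n₀ ≤ n) (hnN : n ≤ N) :
    0 ≤ t n ∧ t n ≤ 100 * (1 + ε₀) ^ (-(5 : ℝ) * n₀ / 2) *
      (1 - (1 + ε₀) ^ (-(249 : ℝ) / 100 * (n - n₀))) / (1 - (1 + ε₀) ^ (-(249 : ℝ) / 100)) := by
  have h1 : (1 : ℝ) < 1 + ε₀ := by linarith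
  have h0 : (0 : ℝ) < 1 + ε₀ := by linarith
  have hρ : (1 + ε₀) ^ (-(249 : ℝ) / 100) < 1 :=
    Real.rpow_lt_one_of_one_lt_of_neg h1 (by norm_num)
  have hρ' : 0 < 1 - (1 + ε₀) ^ (-(249 : ℝ) / 100) := by linarith
  induction n, hn₀ using Int.leInduction with
  | base =>
    refine ⟨le_of_eq h.t_init.symm, ?_⟩
    rw [h.t_init]; simp
  | succ n hmn ih =>
    obtain ⟨ih0, ih1⟩ := ih (by omega)
    have hs := h.step (n + 1) (by omega) hnN
    have hen : (1 + ε₀) ^ (-((n : ℝ) - n₀) / 100) ≤ e n := h.rpow_le_amp hε₀ hmn (by omega)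
    have hepos : 0 < e n := h.amp_pos hmn (by omega)
    have hlife := hs.life_le
    have hlt := hs.lt
    simp only [add_sub_cancel_right] at hlife hlt
    refine ⟨by linarith, ?_⟩
    have hinc : t (n + 1) - t n ≤
        100 * (1 + ε₀) ^ (-(5 : ℝ) * n₀ / 2) * (1 + ε₀) ^ (-(249 : ℝ) / 100 * (n - n₀)) := by
      have hcast : (((n + 1 : ℤ) : ℝ) - 1) = (n : ℝ) := by push_cast; ring
      rw [hcast] at hlife
      have hinv : (e n)⁻¹ ≤ (1 + ε₀) ^ (((n : ℝ) - n₀) / 100) := by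
        have hpos : 0 < (1 + ε₀) ^ (-((n : ℝ) - n₀) / 100) := Real.rpow_pos_of_pos h0 _
        calc (e n)⁻¹ ≤ ((1 + ε₀) ^ (-((n : ℝ) - n₀) / 100))⁻¹ := inv_anti₀ hpos hen
          _ = (1 + ε₀) ^ (((n : ℝ) - n₀) / 100) := by
              rw [← Real.rpow_neg h0.le]; congr 1; ring
      calc t (n + 1) - t n ≤ 100 * (1 + ε₀) ^ (-(5 : ℝ) * n / 2) * (e n)⁻¹ := hlife
        _ ≤ 100 * (1 + ε₀) ^ (-(5 : ℝ) * n / 2) * (1 + ε₀) ^ (((n : ℝ) - n₀) / 100) := by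
            gcongr
        _ = 100 * (1 + ε₀) ^ (-(5 : ℝ) * n₀ / 2) * (1 + ε₀) ^ (-(249 : ℝ) / 100 * (n - n₀)) := by
            have hexp : -(5 : ℝ) * n / 2 + ((n : ℝ) - n₀) / 100 =
                -(5 : ℝ) * n₀ / 2 + -(249 : ℝ) / 100 * (n - n₀) := by ring
            rw [mul_assoc, mul_assoc, ← Real.rpow_add h0, ← Real.rpow_add h0, hexp]
    have hρn : (1 + ε₀) ^ (-(249 : ℝ) / 100 * (((n + 1 : ℤ) : ℝ) - n₀)) =
        (1 + ε₀) ^ (-(249 : ℝ) / 100) * (1 + ε₀) ^ (-(249 : ℝ) / 100 * (n - n₀)) := by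
      have hexp : -(249 : ℝ) / 100 * (((n + 1 : ℤ) : ℝ) - n₀) =
          -(249 : ℝ) / 100 + -(249 : ℝ) / 100 * (n - n₀) := by push_cast; ring
      rw [hexp, Real.rpow_add h0]
    rw [hρn]
    have hA : 0 ≤ 100 * (1 + ε₀) ^ (-(5 : ℝ) * n₀ / 2) := by positivity
    set A := 100 * (1 + ε₀) ^ (-(5 : ℝ) * n₀ / 2) with hA_def
    set ρ := (1 + ε₀) ^ (-(249 : ℝ) / 100) with hρ_def
    set P := (1 + ε₀) ^ (-(249 : ℝ) / 100 * (n - n₀)) with hP_def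
    rw [le_div_iff₀ hρ'] at ih1 ⊢
    nlinarith [ih1, hinc, mul_nonneg hA (le_of_lt hρ')]

/-- A uniform-in-`N` bound `0 ≤ t_n ≤ 100 (1+ε₀)^{-5n₀/2} / (1 - (1+ε₀)^{-249/100})` for
`n₀ ≤ n ≤ N`, any coefficient `γ` (p. 53: "`t_N ≤ T` for some finite `T = T_{ε₀}` independent of
`N`"). [cite: Tao2016AveragedNS, §6.2 p. 53] -/
theorem BlowupCheckpointsWith.time_le_uniform (h : BlowupCheckpointsWith γ ε₀ K ε n₀ N X E t e)
    (hε₀ : 0 < ε₀) {n : ℤ} (hn₀ : n₀ ≤ n) (hnN : n ≤ N) :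
    0 ≤ t n ∧
      t n ≤ 100 * (1 + ε₀) ^ (-(5 : ℝ) * n₀ / 2) / (1 - (1 + ε₀) ^ (-(249 : ℝ) / 100)) := by
  obtain ⟨h0, h1⟩ := h.time_le hε₀ hn₀ hnN
  refine ⟨h0, h1.trans ?_⟩
  have hq1 : (1 : ℝ) < 1 + ε₀ := by linarith
  have hq0 : (0 : ℝ) < 1 + ε₀ := by linarith
  have hρ : (1 + ε₀) ^ (-(249 : ℝ) / 100) < 1 :=
    Real.rpow_lt_one_of_one_lt_of_neg hq1 (by norm_num)
  have hP : 0 ≤ (1 + ε₀) ^ (-(249 : ℝ) / 100 * (n - n₀)) := (Real.rpow_pos_of_pos hq0 _).le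
  have hA : 0 ≤ 100 * (1 + ε₀) ^ (-(5 : ℝ) * n₀ / 2) := by positivity
  rw [div_le_div_iff_of_pos_right (by linarith)]
  nlinarith

end Consequences

/-! ## Theorem 6.2 from Proposition 6.3, general coefficient -/

/-- **The last paragraph of Tao's §6.2 (p. 53), pointwise in the parameters, for any coefficient `γ`**:
if `X, E` obey (6.1)–(6.10) and the blow-up dynamics hold up to every level `N ≥ n₀`, contradiction
(the printed argument uses only (6.11)–(6.15) and the a priori bound (6.1)).
[cite: Tao2016AveragedNS, §6.2 p. 53] -/
theorem TaoODESystem.false_of_blowupCheckpointsWith {γ ε₀ K ε C₁ C₂ : ℝ} {n₀ : ℤ}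
    {X : Fin 4 → ℤ → ℝ → ℝ} {E : ℤ → ℝ → ℝ} (hε₀ : 0 < ε₀)
    (hsol : TaoODESystem ε₀ K ε C₁ C₂ n₀ X E)
    (hdyn : ∀ N : ℤ, n₀ ≤ N → ∃ t e : ℤ → ℝ, BlowupCheckpointsWith γ ε₀ K ε n₀ N X E t e) :
    False := by
  have hq1 : (1 : ℝ) < 1 + ε₀ := by linarith
  have hq0 : (0 : ℝ) < 1 + ε₀ := by linarith
  have hρ : (1 + ε₀) ^ (-(249 : ℝ) / 100) < 1 :=
    Real.rpow_lt_one_of_one_lt_of_neg hq1 (by norm_num)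
  set T : ℝ := 100 * (1 + ε₀) ^ (-(5 : ℝ) * n₀ / 2) / (1 - (1 + ε₀) ^ (-(249 : ℝ) / 100)) + 1
    with hT
  have hTpos : 0 < T := by
    have : 0 ≤ 100 * (1 + ε₀) ^ (-(5 : ℝ) * n₀ / 2) / (1 - (1 + ε₀) ^ (-(249 : ℝ) / 100)) :=
      div_nonneg (by positivity) (by linarith)
    linarith
  obtain ⟨M, hM⟩ := hsol.apriori_X T hTpos
  have hbound : ∀ N : ℤ, n₀ ≤ N → (1 + ε₀) ^ ((999 : ℝ) / 100 * N + n₀ / 100) ≤ M := by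
    intro N hN
    obtain ⟨t, e, h⟩ := hdyn N hN
    obtain ⟨ht0, htT⟩ := h.time_le_uniform hε₀ hN le_rfl
    have hst := h.state N hN le_rfl
    have hMN := hM (t N) ⟨ht0, by linarith⟩ 0 N
    rw [hst.x1_eq, abs_of_pos hst.pos] at hMN
    have heN := h.rpow_le_amp hε₀ hN le_rfl
    calc (1 + ε₀) ^ ((999 : ℝ) / 100 * N + n₀ / 100)
        = (1 + ε₀) ^ ((10 : ℝ) * N) * (1 + ε₀) ^ (-((N : ℝ) - n₀) / 100) := by
          have hexp : (999 : ℝ) / 100 * N + n₀ / 100 = (10 : ℝ) * N + -((N : ℝ) - n₀) / 100 := by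
            ring
          rw [hexp, Real.rpow_add hq0]
      _ ≤ (1 + (1 + ε₀) ^ ((10 : ℝ) * N)) * e N := by
          apply mul_le_mul _ heN (Real.rpow_pos_of_pos hq0 _).le (by positivity)
          linarith [Real.rpow_pos_of_pos hq0 ((10 : ℝ) * N)]
      _ ≤ M := hMN
  obtain ⟨N, hN⟩ : ∃ N : ℤ, n₀ ≤ N ∧ (max 1 (M / ε₀) + 1 : ℝ) ≤ (999 : ℝ) / 100 * N + n₀ / 100 := by
    obtain ⟨N, hN⟩ := exists_int_gt (max (n₀ : ℝ) ((max 1 (M / ε₀) + 1 - n₀ / 100) * 100 / 999))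
    refine ⟨N, ?_, ?_⟩
    · exact_mod_cast ((le_max_left _ _).trans_lt hN).le
    · have := (le_max_right _ _).trans_lt hN
      nlinarith
  have hp : (1 : ℝ) ≤ (999 : ℝ) / 100 * N + n₀ / 100 := by
    linarith [le_max_left (1 : ℝ) (M / ε₀)]
  have hbern := one_add_mul_self_le_rpow_one_add (s := ε₀) (by linarith) hp
  have hle := hbound N hN.1
  have hMε : M < ((999 : ℝ) / 100 * N + n₀ / 100) * ε₀ := by
    have h2 : M / ε₀ < (999 : ℝ) / 100 * N + n₀ / 100 := by
      linarith [le_max_right (1 : ℝ) (M / ε₀)]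
    rwa [div_lt_iff₀ hε₀] at h2
  linarith

/-- **Thm. 6.2 ⇐ Prop. 6.3 with any coefficient `γ`** (Tao, §6.2, p. 53).
[cite: Tao2016AveragedNS, §6.2 p. 53] -/
theorem noGlobalODESolution_of_blowupDynamicsWith {γ : ℝ → ℝ} (h : blowupDynamicsWith γ) :
    noGlobalODESolution := by
  intro ε₀ hε₀ hε₀1
  obtain ⟨K₀, hK⟩ := h ε₀ hε₀ hε₀1
  refine ⟨K₀, fun K hK₀K hKpos => ?_⟩
  obtain ⟨e₀, he₀, hε⟩ := hK K hK₀K hKpos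
  refine ⟨e₀, he₀, fun ε hεpos hεle C₁ C₂ hC₁ hC₂ => ?_⟩
  obtain ⟨N₀, hN⟩ := hε ε hεpos hεle C₁ C₂ hC₁ hC₂
  refine ⟨N₀, fun n₀ hn₀ => ?_⟩
  rintro ⟨X, E, hsol⟩
  exact hsol.false_of_blowupCheckpointsWith hε₀ (hN n₀ hn₀ X E hsol)

/-! ## Proposition 6.3 from Proposition 6.4, general coefficient -/

/-- **Base case of the induction** (Tao, §6.3, p. 53: "one sets `t_{n₀} = 0` and `e_{n₀} = 1`"),
for any coefficient `γ ≥ 0`. [cite: Tao2016AveragedNS, §6.3 p. 53] -/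
theorem TaoODESystem.blowupCheckpointsWith_base {γ ε₀ K ε C₁ C₂ : ℝ} {n₀ : ℤ}
    {X : Fin 4 → ℤ → ℝ → ℝ} {E : ℤ → ℝ → ℝ} (hsol : TaoODESystem ε₀ K ε C₁ C₂ n₀ X E)
    (hγ : 0 ≤ γ) (hε₀ : 0 < ε₀) (hK : 0 < K) (hε : 0 < ε) :
    BlowupCheckpointsWith γ ε₀ K ε n₀ n₀ X E (fun _ => 0) (fun _ => 1) where
  t_init := rfl
  e_init := rfl
  state n hn hn' := by
    obtain rfl : n = n₀ := le_antisymm hn' hn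
    refine ⟨one_pos, by simp [hsol.init_X], ?_, ?_, ?_, ?_, ?_⟩
    · simp [hsol.init_X]; positivity
    · simp [hsol.init_X]; positivity
    · simp [hsol.init_X]; positivity
    · simp [hsol.init_X]; positivity
    · simp [hsol.init_E]; positivity
  step n hn hn' := absurd hn' (not_le.mpr hn)

/-- **Inductive step of the induction**, any coefficient `γ`: extending checkpoints at level `N` by a
pair `(t_{N+1}, e_{N+1})` as produced by Prop. 6.4. [cite: Tao2016AveragedNS, §6.3 p. 53] -/
theorem BlowupCheckpointsWith.extend {γ ε₀ K ε : ℝ} {n₀ N : ℤ} {X : Fin 4 → ℤ → ℝ → ℝ}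
    {E : ℤ → ℝ → ℝ} {t e : ℤ → ℝ} (h : BlowupCheckpointsWith γ ε₀ K ε n₀ N X E t e) (hN : n₀ ≤ N)
    {s a : ℝ} (hst : StateBoundsWith γ ε₀ K ε n₀ X E (N + 1) s a)
    (hsp : StepBounds ε₀ K ε X E (N + 1) (t N) s (e N) a) :
    BlowupCheckpointsWith γ ε₀ K ε n₀ (N + 1) X E (Function.update t (N + 1) s)
      (Function.update e (N + 1) a) where
  t_init := by rw [Function.update_of_ne (by omega)]; exact h.t_init
  e_init := by rw [Function.update_of_ne (by omega)]; exact h.e_init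
  state n hn hn' := by
    rcases lt_or_eq_of_le hn' with hlt | rfl
    · rw [Function.update_of_ne (by omega), Function.update_of_ne (by omega)]
      exact h.state n hn (by omega)
    · rw [Function.update_self, Function.update_self]; exact hst
  step n hn hn' := by
    rcases lt_or_eq_of_le hn' with hlt | rfl
    · rw [Function.update_of_ne (by omega), Function.update_of_ne (by omega),
        Function.update_of_ne (by omega), Function.update_of_ne (by omega)]
      exact h.step n hn (by omega)
    · rw [Function.update_self, Function.update_self, Function.update_of_ne (by omega),
        Function.update_of_ne (by omega), add_sub_cancel_right]
      exact hsp

/-- **Prop. 6.3 ⇐ Prop. 6.4 with any coefficient `γ ≥ 0`** (Tao, §6.3, p. 53: "We do so by an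
induction on `N`"). [cite: Tao2016AveragedNS, §6.3 p. 53] -/
theorem blowupDynamicsWith_of_blowupDynamicsStepWith {γ : ℝ → ℝ} (hγ : ∀ K, 0 < K → 0 ≤ γ K)
    (h : blowupDynamicsStepWith γ) : blowupDynamicsWith γ := by
  intro ε₀ hε₀ hε₀1
  obtain ⟨K₀, hK⟩ := h ε₀ hε₀ hε₀1
  refine ⟨K₀, fun K hK₀K hKpos => ?_⟩
  obtain ⟨e₀, he₀, hε⟩ := hK K hK₀K hKpos
  refine ⟨e₀, he₀, fun ε hεpos hεle C₁ C₂ hC₁ hC₂ => ?_⟩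
  obtain ⟨N₀, hN⟩ := hε ε hεpos hεle C₁ C₂ hC₁ hC₂
  refine ⟨N₀, fun n₀ hn₀ X E hsol N hNn => ?_⟩
  induction N, hNn using Int.leInduction with
  | base => exact ⟨_, _, hsol.blowupCheckpointsWith_base (hγ K hKpos) hε₀ hKpos hεpos⟩
  | succ N hmn ih =>
    obtain ⟨t, e, hce⟩ := ih
    obtain ⟨s, a, hst, hsp⟩ := hN n₀ hn₀ X E hsol N hmn t e hce
    exact ⟨_, _, hce.extend hmn hst hsp⟩

/-- **Thm. 6.2 ⇐ Prop. 6.4 with any coefficient `γ ≥ 0`.** [cite: Tao2016AveragedNS, §6.2–6.3] -/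
theorem noGlobalODESolution_of_blowupDynamicsStepWith {γ : ℝ → ℝ} (hγ : ∀ K, 0 < K → 0 ≤ γ K)
    (h : blowupDynamicsStepWith γ) : noGlobalODESolution :=
  noGlobalODESolution_of_blowupDynamicsWith (blowupDynamicsWith_of_blowupDynamicsStepWith hγ h)

/-- **The printed Prop. 6.4 from Prop. 6.4 with any coefficient `γ ≥ 0`**, in particular from the
corrected one: the route by which `blowupDynamicsStep` is to be discharged.
[cite: Tao2016AveragedNS, §6.2–6.3] -/
theorem blowupDynamicsStep_of_blowupDynamicsStepWith {γ : ℝ → ℝ} (hγ : ∀ K, 0 < K → 0 ≤ γ K)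
    (h : blowupDynamicsStepWith γ) : blowupDynamicsStep :=
  blowupDynamicsStep_of_noGlobalODESolution (noGlobalODESolution_of_blowupDynamicsStepWith hγ h)

/-- In particular the corrected Prop. 6.4 implies the printed one (and Thm. 6.2).
[cite: Tao2016AveragedNS, §6.2–6.3] -/
theorem blowupDynamicsStep_of_corrected (h : blowupDynamicsStepCorrected) : blowupDynamicsStep :=
  blowupDynamicsStep_of_blowupDynamicsStepWith (fun K _ => by positivity) h

end TaoCascade

end Literature.Analysis.FluidPDE
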